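import Mathlib
import HarnessLib

/-!
# The SO(even) one-level-density TEST-FUNCTION extremal problem at Fourier support `v ∈ (1, 2]`:
# value `α(v) = 1/K_{SO(even),πv}(0,0)` in closed form (Carneiro–Chirre–Milinovich 2022, Thm 2 (i) and
# Cor. 8 (ii); Iwaniec–Luo–Sarnak 2000, Appendix A) — DEFINITIONS + ONE NAMED FACT + proved algebra

Topic `Literature/NumberTheory/LFunctions`, sub-namespace `OneDeltaSOEven`. Typed for cell ls-idea on the
OFFER of seat ls-idea-lens-15 (LENSES-v3 `dual`), card K-L15-1 «THE DENSITY DOOR'S EXACT DUAL», sketch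
`HOME/ls-idea-lens-15/Sketch_DensityDual.lean` sha16 d6109a3dc8bc268f (statements only, rc 0): the test-
function optimisation behind the G-25 / K-L7-2 density door («`ω(S_f) ≤ [φ̂(0) + ½∫_{−1}^{1}φ̂]/(2φ(0))`
strictly below `½` iff the support `v` of `φ̂` exceeds `v*`») solved in closed form. Here: the Fourier-side
quadratic form of ILS App. A (`φ̂ = h ∗ h̃`, `h` real on `[−v/2, v/2]`:
`∫φ W(SO(even)) = ∫ h² + ½∬_{|x−y|≤1} h(x)h(y)`, `φ(0) = (∫ h)²`), the printed value
`K_{SO(even),πΔ}(0,0)` (CCM Cor. 8 (ii)), the floor constant `α(v) = 1/K(0,0)` (PROVED algebraically: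
`alphaSOEven_mul_kSOEven`), the extremal three-zone profile (ILS (205) at general support), the door-
threshold equation `tan((v−1)/4) = v/(v+8)` (the seat's: `α(v) = 1` rewritten), and ONE NAMED FACT — the
floor-and-sharpness statement «`α(v)·(∫h)² ≤ ∫h² + ½∬_{|x−y|≤1}hh` for every continuous `h` on
`[−v/2,v/2]`, with equality for a non-null profile», i.e. CCM Thm 2 (i) / §4 (one-delta problem) with
Cor. 8 (ii), in the ILS App. A coordinates. Nothing about `L`-functions or zeros is asserted; «no
exceptional-zero theorem (no Landau–Siegel / Siegel-zero exclusion, no Theorem 1–2 of arXiv:2211.02515, no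
repaired Margin232) is proved by ideation; typed ≠ proved; computed ≠ proved».

## References
* [CarneiroChirreMilinovich2022] E. Carneiro, A. Chirre, M. B. Milinovich, *Hilbert spaces and low-lying
  zeros of L-functions*, Adv. Math. 410 (2022) 108748 = arXiv:2109.10844: Thm 2 (i) (p. 5), Cor. 8 (ii)
  (p. 7: `K_{SO(even),πΔ}(0,0) = 2 − 4cos((Δ−1)/2)/(4 + 4 sin((Δ−1)/2) − Δ cos((Δ−1)/2))`, `1 < Δ ≤ 2`).
  [held: paper:arxiv-2109.10844 p0005:L23–L35, p0007 (Cor. 8)]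
* [IwaniecLuoSarnak2000] H. Iwaniec, W. Luo, P. Sarnak, Publ. Math. IHÉS 91 (2000), Appendix A
  (195)–(206) (the quadratic form, the Fredholm equation, the three-zone extremal function, `(3 + cot ¼)/8`
  at support 2). [held: paper:arxiv-math-9901141]
-/

noncomputable section

namespace Literature.NumberTheory.LFunctions

namespace OneDeltaSOEven

open MeasureTheory Set

/-- `mass v h = ∫_{−v/2}^{v/2} h` — for `φ̂ = h ∗ h̃` this is `φ(0)^{1/2}` up to sign.
[cite: IwaniecLuoSarnak2000, Appendix A (195)] -/
def mass (v : ℝ) (h : ℝ → ℝ) : ℝ := ∫ x in (-(v / 2))..(v / 2), h x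

/-- The SO(even) quadratic form on `[−v/2, v/2]²`:
`⟨(I + K)h, h⟩ = ∫ h² + ½ ∬_{|x−y| ≤ 1} h(x) h(y)` — the value `∫ φ W(SO(even))` for `φ̂ = h ∗ h̃`.
[cite: IwaniecLuoSarnak2000, Appendix A (195)] -/
def soEvenQuad (v : ℝ) (h : ℝ → ℝ) : ℝ :=
  (∫ x in (-(v / 2))..(v / 2), h x ^ 2) +
    (1 / 2) * ∫ x in (-(v / 2))..(v / 2), ∫ y in (-(v / 2))..(v / 2),
      (if |x - y| ≤ 1 then h x * h y else 0)

/-- **CCM 2022, Cor. 8 (ii), the printed special value** `K_{SO(even),πv}(0,0)` for `1 < v ≤ 2`: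
`2 − 4cos((v−1)/2) / (4 + 4 sin((v−1)/2) − v cos((v−1)/2))`. A DEFINITION (the printed closed form).
[cite: CarneiroChirreMilinovich2022, Cor. 8 (ii)] -/
def kSOEven (v : ℝ) : ℝ :=
  2 - 4 * Real.cos ((v - 1) / 2) /
    (4 + 4 * Real.sin ((v - 1) / 2) - v * Real.cos ((v - 1) / 2))

/-- The FLOOR CONSTANT `α(v) := ½ + cos((v−1)/2)/(4 + 4 sin((v−1)/2) − (2+v) cos((v−1)/2))`, the
seat's closed form of `1/K_{SO(even),πv}(0,0)` on `1 < v ≤ 2` (`alphaSOEven_mul_kSOEven`; equals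
`(3 + cot ¼)/8 = 0.8645…` at `v = 2`, ILS (206)). [cite: CarneiroChirreMilinovich2022, Thm 2 (i) and Cor. 8 (ii)] -/
def alphaSOEven (v : ℝ) : ℝ :=
  1 / 2 + Real.cos ((v - 1) / 2) /
    (4 + 4 * Real.sin ((v - 1) / 2) - (2 + v) * Real.cos ((v - 1) / 2))

/-- The extremal («magic») profile, ILS (205) at general support `v`: constant `c₀` on `|x| ≤ 1 − v/2`,
`B·cos(|x|/2 − (π+1)/4)` on `1 − v/2 ≤ |x| ≤ v/2`, with `I = 1/α(v)`, `c₀ = 1 − I/2`,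
`B = c₀ / cos((1 − v/2)/2 − (π+1)/4)` (continuity at `|x| = 1 − v/2`). A DEFINITION.
[cite: IwaniecLuoSarnak2000, Appendix A (205)] -/
def extremalProfile (v : ℝ) (x : ℝ) : ℝ :=
  let I : ℝ := 1 / alphaSOEven v
  let c₀ : ℝ := 1 - I / 2
  let B : ℝ := c₀ / Real.cos ((1 - v / 2) / 2 - (Real.pi + 1) / 4)
  if |x| ≤ 1 - v / 2 then c₀ else B * Real.cos (|x| / 2 - (Real.pi + 1) / 4)

/-- **FLOOR** (the dual certificate, ILS Prop. A.1 shape): `α · mass(h)² ≤ soEvenQuad(h)` for every `h`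
continuous on `[−v/2, v/2]`. A PREDICATE in `(v, α)`; nothing asserted.
[cite: IwaniecLuoSarnak2000, Appendix A, Prop. A.1] -/
def SOEvenFloor (v α : ℝ) : Prop :=
  ∀ h : ℝ → ℝ, ContinuousOn h (Icc (-(v / 2)) (v / 2)) → α * mass v h ^ 2 ≤ soEvenQuad v h

/-- **SHARPNESS**: the floor constant `α` is attained by a non-null continuous profile. A PREDICATE in
`(v, α)`; nothing asserted. [cite: IwaniecLuoSarnak2000, Appendix A (205)–(206)] -/
def SOEvenFloorAttained (v α : ℝ) : Prop :=
  ∃ h : ℝ → ℝ, ContinuousOn h (Icc (-(v / 2)) (v / 2)) ∧ mass v h ≠ 0 ∧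
    soEvenQuad v h = α * mass v h ^ 2

/-- The DOOR-THRESHOLD equation (seat ls-idea-lens-15: `α(v) = 1` rewritten): `1 < v < 2` and
`tan((v−1)/4) = v/(v+8)`; unique root `v* = 1.69101506988…` (the K-L7-2 / quant-1 constant `1.6910`).
A PREDICATE; nothing asserted. [cite: CarneiroChirreMilinovich2022, Cor. 8 (ii) (K(0,0) = 1 solved for Δ)] -/
def IsDoorThreshold (v : ℝ) : Prop :=
  1 < v ∧ v < 2 ∧ Real.tan ((v - 1) / 4) = v / (v + 8)

/-- **Carneiro–Chirre–Milinovich 2022, Thm 2 (i) with Cor. 8 (ii), in the ILS Appendix-A coordinates**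
(the «one-delta» extremal problem for `G = SO(even)`, support `1 < Δ ≤ 2`): the infimum of
`∫ φ W(SO(even)) / φ(0)` over admissible test functions with `supp φ̂ ⊆ [−Δ, Δ]` is `1/K_{SO(even),πΔ}(0,0)`,
attained (ILS (205)–(206): three-zone extremal function, value `(3 + cot ¼)/8` at `Δ = 2`). Rendered: for
`1 < v ≤ 2`, `SOEvenFloor v (alphaSOEven v)` and `SOEvenFloorAttained v (alphaSOEven v)`.
-- TODO(general form): CCM state the bound for every symmetry type and, in (ii), at low-lying heights `t`;
-- the reduction «admissible φ ⟷ φ̂ = h ∗ h̃, h on [−v/2, v/2]» (Ahiezer/Krein, ILS App. A) is part of the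
-- cited statement, not re-derived here.
NAMED FACT, not proved here; users take `(h : carneiroChirreMilinovich2022_oneDelta_soEven)`.
[cite: CarneiroChirreMilinovich2022, Thm 2 (i) and Cor. 8 (ii)] [cite: IwaniecLuoSarnak2000, Appendix A, Prop. A.1 and (205)–(206)] -/
def carneiroChirreMilinovich2022_oneDelta_soEven : Prop :=
  ∀ v : ℝ, 1 < v → v ≤ 2 → SOEvenFloor v (alphaSOEven v) ∧ SOEvenFloorAttained v (alphaSOEven v)

/-! ### Proved algebra -/

/-- The denominator of `α(v)` is positive on `1 < v ≤ 2`: `4 + 4 sin u − (2+v) cos u > 0` for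
`u = (v−1)/2 ∈ (0, ½]` (`sin u > 0`, `(2+v) cos u ≤ 4`). [folklore] -/
private theorem alphaSOEven_den_pos {v : ℝ} (hv1 : 1 < v) (hv2 : v ≤ 2) :
    0 < 4 + 4 * Real.sin ((v - 1) / 2) - (2 + v) * Real.cos ((v - 1) / 2) := by
  have hu0 : 0 < (v - 1) / 2 := by linarith
  have hupi : (v - 1) / 2 < Real.pi := by linarith [Real.pi_gt_three]
  have hsin : 0 < Real.sin ((v - 1) / 2) := Real.sin_pos_of_pos_of_lt_pi hu0 hupi
  have hcos : Real.cos ((v - 1) / 2) ≤ 1 := Real.cos_le_one _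
  have hcos0 : 0 ≤ Real.cos ((v - 1) / 2) :=
    Real.cos_nonneg_of_neg_pi_div_two_le_of_le (by linarith [Real.pi_gt_three])
      (by linarith [Real.pi_gt_three])
  nlinarith

/-- The denominator of `K(0,0)` is positive on `1 < v ≤ 2`. [folklore] -/
private theorem kSOEven_den_pos {v : ℝ} (hv1 : 1 < v) (hv2 : v ≤ 2) :
    0 < 4 + 4 * Real.sin ((v - 1) / 2) - v * Real.cos ((v - 1) / 2) := by
  have h := alphaSOEven_den_pos hv1 hv2
  have hcos0 : 0 ≤ Real.cos ((v - 1) / 2) :=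
    Real.cos_nonneg_of_neg_pi_div_two_le_of_le (by linarith [Real.pi_gt_three])
      (by linarith [Real.pi_gt_three])
  nlinarith

/-- **`α(v) · K_{SO(even),πv}(0,0) = 1` on `1 < v ≤ 2`** (PROVED algebra): the seat's closed form IS the
reciprocal of the printed special value of Cor. 8 (ii). [cite: CarneiroChirreMilinovich2022, Cor. 8 (ii)] -/
theorem alphaSOEven_mul_kSOEven {v : ℝ} (hv1 : 1 < v) (hv2 : v ≤ 2) :
    alphaSOEven v * kSOEven v = 1 := by
  have h1 := alphaSOEven_den_pos hv1 hv2
  have h2 := kSOEven_den_pos hv1 hv2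
  obtain ⟨c, hc⟩ : ∃ c : ℝ, c = Real.cos ((v - 1) / 2) := ⟨_, rfl⟩
  obtain ⟨s, hs⟩ : ∃ s : ℝ, s = Real.sin ((v - 1) / 2) := ⟨_, rfl⟩
  rw [← hc, ← hs] at h1 h2
  have e1 : alphaSOEven v = 1 / 2 + c / (4 + 4 * s - (2 + v) * c) := by rw [alphaSOEven, hc, hs]
  have e2 : kSOEven v = 2 - 4 * c / (4 + 4 * s - v * c) := by rw [kSOEven, hc, hs]
  rw [e1, e2]
  have h1' : 4 + 4 * s - (2 + v) * c ≠ 0 := h1.ne'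
  have h2' : 4 + 4 * s - v * c ≠ 0 := h2.ne'
  -- (1/2 + c/A) = B/(2A) and (2 − 4c/B) = 2A/B with B − 2c = A
  have eA : 1 / 2 + c / (4 + 4 * s - (2 + v) * c) =
      (4 + 4 * s - v * c) / (2 * (4 + 4 * s - (2 + v) * c)) := by
    rw [div_add_div _ _ two_ne_zero h1', div_eq_div_iff (mul_ne_zero two_ne_zero h1')
      (mul_ne_zero two_ne_zero h1')]
    ring
  have eB : 2 - 4 * c / (4 + 4 * s - v * c) =
      2 * (4 + 4 * s - (2 + v) * c) / (4 + 4 * s - v * c) := by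
    rw [eq_div_iff h2', sub_mul, div_mul_cancel₀ _ h2']
    ring
  rw [eA, eB, div_mul_div_comm]
  rw [div_eq_one_iff_eq (mul_ne_zero (mul_ne_zero two_ne_zero h1') h2')]
  ring

/-- Hence `α(v) = 1 / K(0,0)` on `1 < v ≤ 2`. [cite: CarneiroChirreMilinovich2022, Thm 2 (i) and Cor. 8 (ii)] -/
theorem alphaSOEven_eq_inv_kSOEven {v : ℝ} (hv1 : 1 < v) (hv2 : v ≤ 2) :
    alphaSOEven v = 1 / kSOEven v := by
  have h := alphaSOEven_mul_kSOEven hv1 hv2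
  have hk : kSOEven v ≠ 0 := by
    intro h0; rw [h0, mul_zero] at h; exact zero_ne_one h
  field_simp
  linarith [h]

/-- Sanity (proved): the closed form extends continuously to `v = 1` with `α(1) = 3/2 = 1/v + 1/2`
(`= 1/K(0,0)` with `K(0,0) = 2Δ/(2+Δ)` at `Δ = 1`, Cor. 8 (ii) first branch).
[cite: CarneiroChirreMilinovich2022, Cor. 8 (ii)] -/
theorem alphaSOEven_one : alphaSOEven 1 = 3 / 2 := by
  simp [alphaSOEven]
  norm_num

/-- Bookkeeping (proved): the floor is antitone in the constant. [cite: IwaniecLuoSarnak2000, Appendix A, Prop. A.1] -/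
theorem SOEvenFloor.anti {v α β : ℝ} (hβ : β ≤ α) (h : SOEvenFloor v α) : SOEvenFloor v β :=
  fun g hg ↦ le_trans (mul_le_mul_of_nonneg_right hβ (sq_nonneg _)) (h g hg)

end OneDeltaSOEven

end Literature.NumberTheory.LFunctions
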